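import Literature.MathematicalPhysics.QuantumFieldTheory.Balaban1983to89.Node00.Record13Carriers
import Literature.MathematicalPhysics.QuantumFieldTheory.Balaban1983to89.Node00.CarriersB13KernelTower

/-!
# NODE 00 → DAG node N10 — THE [B13] CARRIER PIN RESTATED AT def-T's STAGE 12 → 13 (`Record13`): `Stage13Params.pinB13` (and its kernel-keyed twin `pinB13K`),
# its passage through the Stage-13 view, provisos and datum (UP-SIDE), and N10 at a run bound to the C-binding of the [B13]-pinned Stage-13 view — the ONE-module
# restate of def-B13 g2's `Node00/Record12CarriersB13` §1 with `12 ↦ 13` (seat `pub-ymgap-dag-n10-d` g5 for the stood-down def-B13 base; companion of `Node00/Record13Carriers`)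

NODE 00 RECORD MODULE at Stage 13 for the [B13] group (director-ym №125∕№129 «RECORD 13»; def-T g7∕g8 `Node00/Record13.lean` p486037 → v1.1 p488788).  The [B13] pin
is an `X`-re-binding (`Node00/Record13Carriers`' `Stage13Params.rebindX`): `θ.pinB13 lam := θ.rebindX (XB13OfRecord θ.toStage3Params lam θ.res.X)` with
`lam : B12.RunParams → ResidB13 θ.toStage3Params` a residual [B13] term layer per run (def-B13 g0's `Node00/CarriersB13`), so EVERY g0 ∕ g2 ∕ g3 ∕ g4 face of the [B13]
group — `WtOfRecord`, `c13OfRecord`, `B13LeafOfRecord`, `withB13OfRecord`, `b13_main_iff_rebindX_XB13OfRecord`, the family currency `ResidB13Fam ∕ B13FamLeafOfRecord(₁₂)`,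
the kernel tower `ResidB13K.layer` — applies at Stage 13 BY NAME, and dag-n10-d's ₁₁ ∕ ₁₂ storeys (`…N10AtRecord11B13*`, `…N10AtRecord12B13*`) port by `12 ↦ 13`.
Readings (kernel): `pinB13_toStage12Params : (θ.pinB13 lam).toStage12Params = θ.toStage12Params.pinB13 lam` (`rfl` — the Stage-13 pin IS def-B13 g2's Stage-12 pin
lifted), `toStage5₁₃_pinB13` (`rfl` through `toStage5₁₃_rebindX`), `Provisos₁₃.pinB13`, `datumOfRecord₁₃_pinB13 : rfl` (UP-SIDE).  APPEND-ONLY: a NEW importing module;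
`Record13`, `Record13Carriers`, `CarriersB13*` untouched and CONSUMED BY NAME.

WHAT IS DEFINED ∕ PROVED (kernel bookkeeping, 0 sorry): §1 `Stage13Params.pinB13` (+ `pinB13_X : rfl`, `pinB13_admissible_iff : Iff.rfl`, `pinB13_toStage3Params ∕
_toStage12Params ∕ _ε₂₉ : rfl`, `Provisos₁₃.pinB13`, `toStage5₁₃_pinB13`, `datumOfRecord₁₃_pinB13 : rfl`, `WOfRecord₁₃_pinB13 ∕ F12OfRecord₁₂_pinB13₁₃ : rfl`), the N10
faces `b13_main_iff_toStage5₁₃_pinB13` ∕ `b13_main_at_toStage5₁₃_pinB13` (g0's `b13_main_iff_rebindX_XB13OfRecord` ∕ `b13_main_at_rebindX_XB13OfRecord` at `φ := θ.toStage5₁₃`);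
§2 the kernel-keyed twin `Stage13Params.pinB13K θ lamK := θ.pinB13 (fun P => (lamK P).layer)` (def-B13 g4's `Stage12Params.pinB13K` pattern; `pinB13K_eq ∕ _X ∕
_admissible_iff ∕ _toStage12Params : rfl`).  NOT here (typed on a consumer's ask only): the seven-pin Stage-13 view and the pinned record predicates
(`Record12CarriersB13` §2–§3's `view₁₂B13B12B8B10YZW`, `IsRecordOfRecord₁₂CB10YZWB8B12B13` at ₁₃).  HONEST FRAMING: definitions + kernel bookkeeping (`rfl` ∕ `Iff.rfl` ∕
transport); NO estimate; nothing of Bałaban's asserted or constructed; N10 NOT discharged; K0″ NOT asserted; counts unmoved; one finite T⁴ programme at fixed ε,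
Bałaban as printed — NOT continuum ∕ ℝ⁴ ∕ infinite volume ∕ OS ∕ mass gap ∕ Clay.  No `sorry`, no `axiom`, no `opaque`, no `instance` declaration, no `notation`. -/

noncomputable section

namespace Literature.MathematicalPhysics.QuantumFieldTheory.Balaban1983to89.Node00

open T4Continuum AveragingRT T4FiniteEpsInhabited FlowStep FlowStepRuns DagBinding T4DatumAssembly
open scoped Matrix.Norms.L2Operator

/-! ## §1. The [B13] pin at Stage 13 (an `X`-re-binding through `Record13Carriers.Stage13Params.rebindX`, UP-SIDE) and N10 at the pinned Stage-13 view, BY NAME -/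

section Pin13

variable (F : T4Family) (N : ℕ) [NeZero N]

/-- **The [B13] pin of Stage-13 parameters**: `res.X := XB13OfRecord θ.toStage3Params lam res.X`, everything else unchanged (`Record13Carriers`' generic Stage-13
`rebindX`; def-B13 g2's `Stage12Params.pinB13` lifted). [cite: Balaban1988RG2Cluster, Lemmas 1–3 pp.9–20 (objects of record, Stage 3′(X.B13))] -/
def Stage13Params.pinB13 (θ : Stage13Params F N) (lam : B12.RunParams → ResidB13 θ.toStage3Params) : Stage13Params F N :=
  θ.rebindX F N (XB13OfRecord θ.toStage3Params lam θ.res.X)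

/-- The pinned carrier family, unfolded (`rfl`). [cite: Balaban1988RG2Cluster, Lemmas 1–3 (bookkeeping)] -/
theorem Stage13Params.pinB13_X (θ : Stage13Params F N) (lam : B12.RunParams → ResidB13 θ.toStage3Params) (P : B12.RunParams) :
    (θ.pinB13 F N lam).res.X P = (θ.res.X P).withB13OfRecord θ.toStage3Params (lam P) := rfl

/-- The Stage-13 pin IS def-B13 g2's Stage-12 pin lifted through `toStage12Params` (`rfl`). [cite: Balaban1988RG2Cluster, Lemmas 1–3 (bookkeeping)] -/
theorem Stage13Params.pinB13_toStage12Params (θ : Stage13Params F N) (lam : B12.RunParams → ResidB13 θ.toStage3Params) :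
    (θ.pinB13 F N lam).toStage12Params = θ.toStage12Params.pinB13 F N lam := rfl

/-- The pin touches neither admissibility (`Iff.rfl`) … [cite: Balaban1987RG1, (1.20)–(1.21) p.264 (hypothesis dictionary; bookkeeping)] -/
theorem Stage13Params.pinB13_admissible_iff (θ : Stage13Params F N) (lam : B12.RunParams → ResidB13 θ.toStage3Params) :
    (θ.pinB13 F N lam).Admissible F N ↔ θ.Admissible F N := Iff.rfl

/-- … nor the Stage-3 dictionary (`rfl`) … [cite: Balaban1984PropagatorsII, pp.223–250 (bookkeeping)] -/
theorem Stage13Params.pinB13_toStage3Params (θ : Stage13Params F N) (lam : B12.RunParams → ResidB13 θ.toStage3Params) :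
    (θ.pinB13 F N lam).toStage3Params = θ.toStage3Params := rfl

/-- … nor the numeric letter `ε₂₉` of the (2.9) species (`rfl`). [cite: Balaban1987RG1, (2.9) p.266 (bookkeeping)] -/
theorem Stage13Params.pinB13_ε₂₉ (θ : Stage13Params F N) (lam : B12.RunParams → ResidB13 θ.toStage3Params) : (θ.pinB13 F N lam).ε₂₉ = θ.ε₂₉ := rfl

/-- … nor the [IV] bundle of record and the [B12] frame of record (`rfl` ×2). [cite: Balaban1989LargeFieldI, (0.2) p.176; Balaban1987RG1, Lemma 4 (3.53) p.280 (bookkeeping)] -/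
theorem WOfRecord₁₃_F12OfRecord₁₂_pinB13 (θ : Stage13Params F N) (lam : B12.RunParams → ResidB13 θ.toStage3Params) (lamW : ResidW F N) (lam12 : ResidB12 F N θ.τ9.M)
    (p : B12.RunParams) :
    WOfRecord₁₃ F N (θ.pinB13 F N lam) lamW = WOfRecord₁₃ F N θ lamW ∧
      F12OfRecord₁₂ F N (θ.pinB13 F N lam).toStage12Params lam12 p = F12OfRecord₁₂ F N θ.toStage12Params lam12 p := ⟨rfl, rfl⟩

variable {F N} in
/-- The Stage-13 provisos transport along the [B13] pin (`Record13Carriers.Stage13Params.Provisos₁₃.rebindX`: they read no carrier). [cite: Balaban1988Convergent, (2.23)–(2.42) pp.259–262 (bookkeeping)] -/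
theorem Stage13Params.Provisos₁₃.pinB13 {θ : Stage13Params F N} (h : θ.Provisos₁₃ F N) (lam : B12.RunParams → ResidB13 θ.toStage3Params) :
    (θ.pinB13 F N lam).Provisos₁₃ F N :=
  h.rebindX _

/-- The Stage-13 view of [B13]-pinned parameters IS the re-bound Stage-13 view (`Record13Carriers.Stage13Params.toStage5₁₃_rebindX`). [cite: Balaban1988Convergent, p.244 (bookkeeping)] -/
theorem Stage13Params.toStage5₁₃_pinB13 (θ : Stage13Params F N) (lam : B12.RunParams → ResidB13 θ.toStage3Params) :
    (θ.pinB13 F N lam).toStage5₁₃ F N = (θ.toStage5₁₃ F N).rebindX F N (XB13OfRecord θ.toStage3Params lam θ.res.X) :=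
  Stage13Params.toStage5₁₃_rebindX F N θ _

/-- THE PIN IS UP-SIDE: the datum of record is unchanged (`Record13Carriers.datumOfRecord₁₃_rebindX`). [cite: Balaban1989LargeFieldII, Thm 1 + (0.1) pp.355–356 (bookkeeping)] -/
theorem datumOfRecord₁₃_pinB13 (θ : Stage13Params F N) (h : θ.Provisos₁₃ F N) (lam : B12.RunParams → ResidB13 θ.toStage3Params) :
    datumOfRecord₁₃ F N (θ.pinB13 F N lam) (h.pinB13 lam) = datumOfRecord₁₃ F N θ h :=
  datumOfRecord₁₃_rebindX F N θ h _ (h.pinB13 lam)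

variable {F N}

/-- **N10 AT A RUN BOUND TO THE C-BINDING OF THE [B13]-PINNED STAGE-13 VIEW** (`CarriersB13.b13_main_iff_rebindX_XB13OfRecord` at `φ := θ.toStage5₁₃`, through `toStage5₁₃_pinB13`):
«b9 → b10 → b11 → b12 → b13» with `b13` THE LEAF AT THE GROUP OF RECORD, the in-edges at `θ`'s (residual) carriers `res.Y ∕ res.X ∕ res.Z` (the Stage-13 view keeps them, `rfl`).
[cite: Balaban1988RG2Cluster, Lemmas 1–3 pp.9, 11, 20 (the node at the objects of record)] -/
theorem b13_main_iff_toStage5₁₃_pinB13 (θ : Stage13Params F N) (lam : B12.RunParams → ResidB13 θ.toStage3Params) (w : WorldP) (P : B12.RunParams)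
    (hup : w.up P = upOfRecord₅C F N ((θ.pinB13 F N lam).toStage5₁₃ F N) P) :
    Dag.B13_main (leavesP w P) ↔
      (B9LeafX (θ.res.Y P) → (B10.Thm1PrintedCompact (θ.res.X P).runs10 ∧ B10.Thm2Printed (θ.res.X P).runs10) → B11Leaf (θ.res.Z P) →
        B12Sec2to5.Lemma4Printed (θ.res.X P).F12 (θ.res.X P).c12 → B13LeafOfRecord θ.toStage3Params (lam P)) := by
  rw [Stage13Params.toStage5₁₃_pinB13] at hup
  exact b13_main_iff_rebindX_XB13OfRecord (θ.toStage5₁₃ F N) lam θ.res.X w P hup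

/-- **N10 AT `(w, P)` FROM THE TORUS LEAF TRIPLE AT THE STEP OF RECORD, at the C-binding of the [B13]-pinned Stage-13 view** (`CarriersB13.b13_main_at_rebindX_XB13OfRecord` at
`φ := θ.toStage5₁₃`). [cite: Balaban1988RG2Cluster, Lemma 1 p.9, Lemma 2 p.11, Lemma 3 p.20] -/
theorem b13_main_at_toStage5₁₃_pinB13 (θ : Stage13Params F N) (lam : B12.RunParams → ResidB13 θ.toStage3Params) (w : WorldP) (P : B12.RunParams)
    (hup : w.up P = upOfRecord₅C F N ((θ.pinB13 F N lam).toStage5₁₃ F N) P)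
    (hleaf : B9LeafX (θ.res.Y P) → (B10.Thm1PrintedCompact (θ.res.X P).runs10 ∧ B10.Thm2Printed (θ.res.X P).runs10) → B11Leaf (θ.res.Z P) →
      B12Sec2to5.Lemma4Printed (θ.res.X P).F12 (θ.res.X P).c12 →
        B13.Lemma1Printed (WtOfRecord θ.toStage3Params (lam P)).toStepData (c13OfRecord θ.toStage3Params (lam P)) ∧
          B13.Lemma2Printed (WtOfRecord θ.toStage3Params (lam P)).toStepData (c13OfRecord θ.toStage3Params (lam P)) ∧
            B13.Lemma3Printed (WtOfRecord θ.toStage3Params (lam P)).toStepData (c13OfRecord θ.toStage3Params (lam P))) :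
    Dag.B13_main (leavesP w P) := by
  rw [Stage13Params.toStage5₁₃_pinB13] at hup
  exact b13_main_at_rebindX_XB13OfRecord (θ.toStage5₁₃ F N) lam θ.res.X w P hup hleaf

end Pin13

/-! ## §2. The kernel-keyed [B13] pin at Stage 13 (def-B13 g4's `Stage12Params.pinB13K` pattern at the run-indexed layers of record) -/

section Pin13K

variable (F : T4Family) (N : ℕ) [NeZero N]

/-- **The kernel-keyed [B13] pin of Stage-13 parameters**: `pinB13` at the run-indexed layers of record of kernel-keyed layers (so every §1 face — `pinB13_X`,
`pinB13_admissible_iff`, `pinB13_toStage3Params`, `datumOfRecord₁₃_pinB13`, `b13_main_at_toStage5₁₃_pinB13` — applies BY NAME).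
[cite: Balaban1988RG2Cluster, Lemmas 1–3 pp.9–20 and (2.14) p.15 (objects of record)] -/
def Stage13Params.pinB13K (θ : Stage13Params F N) (lamK : B12.RunParams → ResidB13K θ.toStage3Params) : Stage13Params F N :=
  θ.pinB13 F N fun P => (lamK P).layer

/-- Unfolding (`rfl`). [cite: Balaban1988RG2Cluster, Lemmas 1–3 pp.9–20 (bookkeeping)] -/
theorem Stage13Params.pinB13K_eq (θ : Stage13Params F N) (lamK : B12.RunParams → ResidB13K θ.toStage3Params) :
    θ.pinB13K F N lamK = θ.pinB13 F N (fun P => (lamK P).layer) := rfl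

/-- The pinned carrier family, unfolded (`rfl`). [cite: Balaban1988RG2Cluster, Lemmas 1–3 (bookkeeping)] -/
theorem Stage13Params.pinB13K_X (θ : Stage13Params F N) (lamK : B12.RunParams → ResidB13K θ.toStage3Params) (P : B12.RunParams) :
    (θ.pinB13K F N lamK).res.X P = (θ.res.X P).withB13OfRecord θ.toStage3Params (lamK P).layer := rfl

/-- The kernel-keyed Stage-13 pin IS def-B13 g4's kernel-keyed Stage-12 pin lifted (`rfl`). [cite: Balaban1988RG2Cluster, (2.14) p.15 (bookkeeping)] -/
theorem Stage13Params.pinB13K_toStage12Params (θ : Stage13Params F N) (lamK : B12.RunParams → ResidB13K θ.toStage3Params) :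
    (θ.pinB13K F N lamK).toStage12Params = θ.toStage12Params.pinB13K F N lamK := rfl

/-- The pin touches neither admissibility (`Iff.rfl`) … [cite: Balaban1987RG1, (1.20)–(1.21) p.264 (bookkeeping)] -/
theorem Stage13Params.pinB13K_admissible_iff (θ : Stage13Params F N) (lamK : B12.RunParams → ResidB13K θ.toStage3Params) :
    (θ.pinB13K F N lamK).Admissible F N ↔ θ.Admissible F N := Iff.rfl

/-- … nor the Stage-3 dictionary (`rfl`). [cite: Balaban1984PropagatorsII, pp.223–250 (bookkeeping)] -/
theorem Stage13Params.pinB13K_toStage3Params (θ : Stage13Params F N) (lamK : B12.RunParams → ResidB13K θ.toStage3Params) :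
    (θ.pinB13K F N lamK).toStage3Params = θ.toStage3Params := rfl

end Pin13K

end Literature.MathematicalPhysics.QuantumFieldTheory.Balaban1983to89.Node00

end
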